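import Summits.BirchSwinnertonDyer.BirchSwinnertonDyer.Theorems.EisensteinPrimesMazurTwinFamilyTowerRouteT
import Summits.BirchSwinnertonDyer.BirchSwinnertonDyer.Theorems.EisensteinPrimesAnalyticLambdaParityLemma
import Literature.NumberTheory.EllipticCurves.RationalTorsionMultiplicativeCongruenceProofs
import HarnessLib

/-!
# Route `EisensteinPrimes`, line `mudescent`, stub `stub_lambdaCount_offLocus` (crux 3): the PARITY DATUM
# of the LEAD's route-T-from-the-tower closure on the Mazur twin family is DISCHARGED (helper; closes nothing)

Seat `bsd-eis-lam-a` g13 (ANALYTIC half of stub 4), item stmt-BirchSwinnertonDyer-19033 (crux 3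
`MazurMCOnCellB`, skeleton `Lines/mudescent.lean` bcae135b). The LEAD `bsd-line-x2-p1` landed the
ALGEBRAIC half on the Mazur twin family (`EisensteinPrimesMazurTwinFamilyTowerRouteT`,
`X2.mazurMainConjectureAt_etaleEnd_twinFamily_of_valueCongr_unit`: THEOREM B′'s value congruence +
the tower budget with torsion ⇒ Mazur's main conjecture at the étale end of a twin-family pair) with ONE
parity binder `hSodd : Odd (splitPrimesOutside W p q).card` and asked this seat for its discharge
(STATUS 2026-08-28T06:33:32Z). This file discharges it from the sign theorem of
`EisensteinPrimesAnalyticLambdaParityLemma` (§1, `even_analyticRank_iff_odd_card_split`: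
`r_an ≡ 1 + #{split primes} (mod 2)` on a squarefree conductor): on the twin family `p` is split
(`p ∣ #E(ℚ)_tors`, `X2.hasSplitMultiplicativeReductionAtPrime_of_dvd_torsionOrder`) and the Eisenstein
prime `q ≡ 1 (mod p)` is split (a non-split multiplicative `q` would be `≡ −1 (mod p)`,
`TorsionMultCongruence.cast_eq_neg_one_of_nonsplit_of_dvd_torsionOrder`, Silverman VII.6.1 / Ex. 3.5),
so `#{split primes} = #splitPrimesOutside W p q + 2`, odd at analytic rank `0`.

* §1 `splitPrimesOutside_eq_erase_erase`, `card_splitPrimesOutside_add_two` — bookkeeping;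
* §2 `X2.odd_card_splitPrimesOutside_of_even_analyticRank` — semistable `W`, `r_an` even, `p ≠ 2`
  multiplicative with `p ∣ #E(ℚ)_tors`, `q ≠ p` a prime of the conductor with `q ≡ 1 (mod p)`:
  `#splitPrimesOutside W p q` is ODD; `MazurTwinFamilyAt.odd_card_splitPrimesOutside` on the family;
* §3 `X2.mazurMainConjectureAt_etaleEnd_twinFamily_of_valueCongr_unit'` — the LEAD's theorem with the
  parity binder REMOVED (same named PUBLISHED facts `hWu hpar h415 h310 hGZK hPT hEP`; THEOREM B′'s
  congruence `hval` stays a HYPOTHESIS — on paper, not in print as such, lam-a MEMO-10); and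
  `X2.mazurMainConjectureAt_of_analyticLambdaEq_of_towerBudget'` — the LEAD's census-row route T with
  its binder `hNodd : Odd λ_an` REMOVED (tree `X2.analyticLambdaEq_parity` at the split prime).

HONEST FRAMING (cell `bsd-eis`): THEOREMS ONLY, no definition, no new named fact; closes no stub;
0 cells / labels move; Mazur's main conjecture is proved here for NO curve unconditionally (the value
congruence and the named facts are hypotheses). References: [Mazur1977] III Cor. (8.5);
[KellockDokchitser2023] Cor. 2.5; [SilvermanAEC2009] VII.6.1, Ex. 3.5; [GreenbergLNM1716] Prop. 3.10.
-/

-- `Summit.BirchSwinnertonDyer.BirchSwinnertonDyer.…`: the summit and its single sub-problem share a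
-- name (D-0017 layout), as in every `EisensteinPrimes*` Theorems file.
set_option linter.dupNamespace false
set_option autoImplicit false

noncomputable section

open scoped Classical MatrixGroups ModularForm

open PowerSeries CongruenceSubgroup WeierstrassCurve NumberField IsDedekindDomain
  Literature.NumberTheory.EllipticCurves
  Literature.NumberTheory.EllipticCurves.ModularForms
  Literature.NumberTheory.EllipticCurves.Rank1Residual
  Literature.NumberTheory.EllipticCurves.GreenbergVatsal2000
  Literature.NumberTheory.EllipticCurves.Wuthrich2014
  Literature.NumberTheory.EllipticCurves.Greenberg1999
  Literature.NumberTheory.GaloisCohomology Literature.NumberTheory.GaloisRepresentations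
  Summit.BirchSwinnertonDyer.Rank1Residual
  Summit.BirchSwinnertonDyer.Rank1Residual.X1.MuLambda
  Summit.BirchSwinnertonDyer.Rank1Residual.X1.TamagawaSqueeze
  Summit.BirchSwinnertonDyer.BirchSwinnertonDyer.Theorems.EisensteinPrimesMazurTwinFamily
  Summit.BirchSwinnertonDyer.BirchSwinnertonDyer.Theorems.EisensteinPrimesMazurMCOnCellBTowerRouteT
  Summit.BirchSwinnertonDyer.BirchSwinnertonDyer.Theorems.EisensteinPrimesMazurTwinFamilyTowerRouteT
  Summit.BirchSwinnertonDyer.BirchSwinnertonDyer.Theorems.EisensteinPrimesAnalyticLambdaParityLemma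

namespace Summit.BirchSwinnertonDyer.BirchSwinnertonDyer.Theorems.EisensteinPrimesMazurTwinFamilyTowerRouteTParity

/-! ## §1. Book-keeping: `splitPrimesOutside W p q` is the set of split primes minus `{p, q}` -/

section Bookkeeping

variable (W : WeierstrassCurve ℚ) [W.IsElliptic] [W.IsGloballyMinimal] (p q : ℕ)

/-- `splitPrimesOutside W p q` (p589499) is the set of split multiplicative primes of `N_W` with `p`
and `q` removed. [cite: GreenbergVatsal2000, §1 (9)–(10)] -/
theorem splitPrimesOutside_eq_erase_erase :
    splitPrimesOutside W p q = (((W.conductorNorm ℤ).primeFactors.filter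
      (fun ℓ ↦ ∃ hℓ : ℓ.Prime, @WeierstrassCurve.HasSplitMultiplicativeReductionAtPrime W ℓ ⟨hℓ⟩)).erase
        p).erase q := by
  ext ℓ
  rw [mem_splitPrimesOutside, Finset.mem_erase, Finset.mem_erase, Finset.mem_filter,
    Nat.mem_primeFactors]
  constructor
  · rintro ⟨hdvd, hN0, hnep, hneq, hℓ, hs⟩
    exact ⟨hneq, hnep, ⟨hℓ, hdvd, hN0⟩, hℓ, hs⟩
  · rintro ⟨hneq, hnep, ⟨hℓ, hdvd, hN0⟩, hℓ', hs⟩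
    exact ⟨hdvd, hN0, hnep, hneq, hℓ', hs⟩

/-- If `p ≠ q` are both split multiplicative primes of `N_W`, then `#splitPrimesOutside W p q + 2` is
the number of split multiplicative primes. [cite: GreenbergVatsal2000, §1 (9)–(10)] -/
theorem card_splitPrimesOutside_add_two [Fact p.Prime] [Fact q.Prime] (hpq : p ≠ q)
    (hpN : p ∣ W.conductorNorm ℤ) (hps : W.HasSplitMultiplicativeReductionAtPrime p)
    (hqN : q ∣ W.conductorNorm ℤ) (hqs : W.HasSplitMultiplicativeReductionAtPrime q) :
    (splitPrimesOutside W p q).card + 2 = ((W.conductorNorm ℤ).primeFactors.filter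
      (fun ℓ ↦ ∃ hℓ : ℓ.Prime, @WeierstrassCurve.HasSplitMultiplicativeReductionAtPrime W ℓ ⟨hℓ⟩)).card := by
  have hN0 : W.conductorNorm ℤ ≠ 0 := (W.conductorNorm_pos_holds).ne'
  set S := (W.conductorNorm ℤ).primeFactors.filter
      (fun ℓ ↦ ∃ hℓ : ℓ.Prime, @WeierstrassCurve.HasSplitMultiplicativeReductionAtPrime W ℓ ⟨hℓ⟩) with hS
  have hpS : p ∈ S := by
    rw [hS, Finset.mem_filter, Nat.mem_primeFactors]
    exact ⟨⟨Fact.out, hpN, hN0⟩, Fact.out, hps⟩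
  have hqS : q ∈ S.erase p := by
    rw [Finset.mem_erase, hS, Finset.mem_filter, Nat.mem_primeFactors]
    exact ⟨fun h ↦ hpq h.symm, ⟨Fact.out, hqN, hN0⟩, Fact.out, hqs⟩
  rw [splitPrimesOutside_eq_erase_erase, ← Finset.card_erase_add_one hpS,
    ← Finset.card_erase_add_one hqS]

end Bookkeeping

/-! ## §2. The parity datum `#splitPrimesOutside W p q` odd -/

section Parity

variable (W : WeierstrassCurve ℚ) [W.IsElliptic] [W.IsGloballyMinimal] (p q : ℕ) [hp : Fact p.Prime]

/-- **The parity datum of route T on the twin family is a theorem.** `W / ℚ` globally minimal with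
SQUAREFREE conductor and EVEN analytic rank (e.g. `r_an = 0`), `p ≠ 2` multiplicative with
`p ∣ #E(ℚ)_tors` (so `p` is SPLIT, `X2.hasSplitMultiplicativeReductionAtPrime_of_dvd_torsionOrder`),
`q ≠ p` a prime of the conductor with `q ≡ 1 (mod p)` (so `q` is SPLIT: a non-split multiplicative
`q` of a curve with a rational `p`-point is `≡ −1 (mod p)`, Silverman VII.6.1 / Ex. 3.5, tree
`TorsionMultCongruence.cast_eq_neg_one_of_nonsplit_of_dvd_torsionOrder`). Then
**`#splitPrimesOutside W p q` is ODD**: `#{split} = #splitPrimesOutside W p q + 2` and `#{split}` is odd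
by `even_analyticRank_iff_odd_card_split` (modularity datum from `hpar`).
[cite: KellockDokchitser2023, Cor. 2.5] [cite: SilvermanAEC2009, Thm VII.6.1 and Exercise 3.5] -/
theorem X2.odd_card_splitPrimesOutside_of_even_analyticRank
    (hpar : nonempty_modularParametrizationData) (hsq : Squarefree (W.conductorNorm ℤ))
    (hr : Even W.analyticRank) (hp2 : p ≠ 2) (hmult : W.HasMultiplicativeReductionAtPrime p)
    (htors : p ∣ W.torsionOrder) (hq : q.Prime) (hqp : q ≠ p) (hqN : q ∣ W.conductorNorm ℤ)
    (hq1 : (q : ZMod p) = 1) : Odd (splitPrimesOutside W p q).card := by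
  haveI : Fact q.Prime := ⟨hq⟩
  haveI : NeZero (W.conductorNorm ℤ) := ⟨(W.conductorNorm_pos_holds).ne'⟩
  have hpP : p.Prime := hp.out
  have hp3 : 3 ≤ p := by have h2 := hpP.two_le; omega
  -- `p` is split and divides the conductor
  have hps : W.HasSplitMultiplicativeReductionAtPrime p :=
    X2.hasSplitMultiplicativeReductionAtPrime_of_dvd_torsionOrder W p hp3 hmult htors
  have hpN : p ∣ W.conductorNorm ℤ :=
    (W.dvd_conductorNorm_iff_not_hasGoodReductionAtPrime p).mpr
      (WeierstrassCurve.HasMultiplicativeReduction.not_hasGoodReduction ℤ_[p] hmult)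
  -- `q` is multiplicative (squarefree conductor) and split (`q ≡ 1`, not `−1`, mod the odd `p`)
  have hqm : W.HasMultiplicativeReductionAtPrime q :=
    hasMultiplicativeReductionAtPrime_of_dvd_of_squarefree W hsq q hqN
  have hqs : W.HasSplitMultiplicativeReductionAtPrime q := by
    by_contra hns
    have hneg : (q : ZMod p) = -1 :=
      TorsionMultCongruence.cast_eq_neg_one_of_nonsplit_of_dvd_torsionOrder W q hpP hp2
        (fun h ↦ hqp h.symm) htors hqm hns
    rw [hq1] at hneg
    have h2 : ((2 : ℕ) : ZMod p) = 0 := by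
      rw [Nat.cast_two, show (2 : ZMod p) = 1 + 1 from one_add_one_eq_two.symm]
      nth_rewrite 1 [hneg]
      rw [neg_add_cancel]
    rw [ZMod.natCast_eq_zero_iff] at h2
    exact hp2 ((Nat.prime_dvd_prime_iff_eq hpP Nat.prime_two).mp h2)
  -- count
  obtain ⟨Dm⟩ := hpar W
  have hf : IsNewformOf W Dm.f := Dm.isNewformOf
  have hodd := (even_analyticRank_iff_odd_card_split W hf hsq).mp hr
  rw [← card_splitPrimesOutside_add_two W p q (fun h ↦ hqp h.symm) hpN hps hqN hqs] at hodd
  rcases Nat.even_or_odd (splitPrimesOutside W p q).card with h | h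
  · exact absurd hodd (Nat.not_odd_iff_even.mpr (h.add even_two))
  · exact h

variable {W p q} in
/-- **On the Mazur twin family at analytic rank `0` the parity datum holds**: `MazurTwinFamilyAt W p q`
(squarefree conductor, `q ∣ N` prime, `q ≠ p`, `q ≡ 1 (mod p)`, `p ∣ #E(ℚ)_tors`), `p ≠ 2` multiplicative,
`r_an = 0` ⇒ `#splitPrimesOutside W p q` is odd (and `Σ_{ℓ ∈ splitPrimesOutside W p q} s_ℓ` is odd,
`odd_sum_sFactor_iff`). [cite: Mazur1977, III Cor. (8.5)] [cite: KellockDokchitser2023, Cor. 2.5] -/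
theorem MazurTwinFamilyAt.odd_card_splitPrimesOutside (htw : MazurTwinFamilyAt W p q)
    (hpar : nonempty_modularParametrizationData) (hp2 : p ≠ 2)
    (hmult : W.HasMultiplicativeReductionAtPrime p) (hr0 : W.analyticRank = 0) :
    Odd (splitPrimesOutside W p q).card :=
  X2.odd_card_splitPrimesOutside_of_even_analyticRank W p q hpar htw.squarefree_conductor
    (by rw [hr0]; exact ⟨0, rfl⟩) hp2 hmult htw.dvd_torsionOrder htw.prime htw.ne htw.dvd_conductor
    htw.cast_eq_one

end Parity

/-! ## §3. The LEAD's twin-family route T with the parity binder discharged -/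

section RouteT

variable {W : WeierstrassCurve ℚ} [W.IsElliptic] [W.IsGloballyMinimal] {p q : ℕ} [hp : Fact p.Prime]
variable {N : ℕ} [NeZero N] {f : CuspForm (Gamma0 N) 2} {ϖ : ℚ} {L : PowerSeries ℚ_[p]}

/-- **Mazur's main conjecture at the étale end of a Mazur twin-family pair from THEOREM B′'s value
congruence and the tower budget — parity-free form** of the LEAD's
`X2.mazurMainConjectureAt_etaleEnd_twinFamily_of_valueCongr_unit` (p609840/`…MazurTwinFamilyTowerRouteT`):
the binder `hSodd : Odd (splitPrimesOutside W p q).card` is supplied by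
`MazurTwinFamilyAt.odd_card_splitPrimesOutside` (semistable sign theorem + torsion congruences); every
other hypothesis VERBATIM — `W` globally minimal, `r_an = 0`, `p ≠ 2` multiplicative,
`MazurTwinFamilyAt W p q`, `v_p(#E(ℚ)_tors) = 1`, ONE datum `(f, ϖ, L, G)` with THEOREM B′'s congruence
against `c·U·∏_{ℓ ∈ splitPrimesOutside W p q}(1 − γ_ℓ)` (HYPOTHESIS `hval`: THEOREM B′ is on paper),
named PUBLISHED facts `hWu hpar h415 h310 hGZK hPT hEP`. Nothing is proved for any curve unconditionally.
[cite: Mazur1977, III Cor. (8.5)] [cite: GreenbergLNM1716, Prop. 3.10, Prop. 4.15 (ii), §5 pp. 114–118, p. 137]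
[cite: Wuthrich2014, Thm. 16 (p. 397)] -/
theorem X2.mazurMainConjectureAt_etaleEnd_twinFamily_of_valueCongr_unit' (hp2 : p ≠ 2)
    (hWu : thm16_charIdeal_dvd_multiplicative_of_reducible)
    (hpar : nonempty_modularParametrizationData)
    (h415 : prop415ii_noFiniteSubmodule_of_ordinary_or_multiplicative)
    (h310 : prop310_selmerCorank_mod_two_eq_lambdaInvariant)
    (hGZK : rank_eq_analyticRank_of_analyticRank_le_one)
    (hPT : ∀ (n : ℕ) (κ : ZpExtension ℚ p) [NumberField (κ.layer n)], κ.IsCyclotomic →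
      poitouTate_selmerStructure_duality (κ.layer n))
    (hEP : ∀ (n : ℕ) (κ : ZpExtension ℚ p) [NumberField (κ.layer n)], κ.IsCyclotomic →
      ∀ w : HeightOneSpectrum (𝓞 (κ.layer n)),
      localEulerPoincareCharacteristic (w.adicCompletion (κ.layer n)))
    (hmult : W.HasMultiplicativeReductionAtPrime p) (htw : MazurTwinFamilyAt W p q)
    (hfac : (W.torsionOrder).factorization p = 1) (hr0 : W.analyticRank = 0)
    (hf : IsNewformOf W f) (hϖ : (ϖ : ℝ) * W.realPeriodRat = plusPeriod f)
    (hLs : W.HasSplitMultiplicativeReductionAtPrime p → IsSplitMultPAdicLFunctionOf f p L)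
    (hLn : ¬ W.HasSplitMultiplicativeReductionAtPrime p → IsMultPAdicLFunctionOf f p (-1) L)
    {G : IwasawaAlgebra p} (hG : iwasawaToPowerSeries p G = PowerSeries.C ((ϖ : ℚ) : ℚ_[p]) * L)
    {U : IwasawaAlgebra p} (hU : IsUnit U) {c : ℤ_[p]} (hc : IsUnit c) {n₀ : ℕ}
    (hval : ∀ m : ℕ, n₀ ≤ m → ∀ ζ : ℂ_[p], IsPrimitiveRoot ζ (p ^ (m + 1)) →
      ‖∑' k, ((algebraMap ℚ_[p] ℂ_[p]).comp (algebraMap ℤ_[p] ℚ_[p]))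
          (PowerSeries.coeff k (G - PowerSeries.C c *
            (U * ∏ ℓ ∈ splitPrimesOutside W p q, (1 - frobeniusSeries p ℓ)))) * (ζ - 1) ^ k‖ ≤ (p : ℝ)⁻¹) :
    X2.MazurMainConjectureAt W p :=
  X2.mazurMainConjectureAt_etaleEnd_twinFamily_of_valueCongr_unit hp2 hWu hpar h415 h310 hGZK hPT hEP
    hmult htw hfac hr0 hf hϖ hLs hLn hG hU hc hval
    (MazurTwinFamilyAt.odd_card_splitPrimesOutside htw hpar hp2 hmult hr0)


/-- **Route T from the tower at a split Eisenstein prime — parity-free form** of the LEAD's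
`X2.mazurMainConjectureAt_of_analyticLambdaEq_of_towerBudget` (p609840): its binder `hNodd : Odd N`
(`N = λ_an`) is the tree's `X2.analyticLambdaEq_parity` at a SPLIT prime (forced by `p ∣ #E(ℚ)_tors`,
`X2.hasSplitMultiplicativeReductionAtPrime_of_dvd_torsionOrder`) and `r_an = 0`: `λ_an + r_an` is odd.
Every other hypothesis VERBATIM (census rows `S`, `m`, `hSp`, `hval`, `hcv`; `μ_an = 0`, `λ_an = N`,
`N ≤ Σ_v p^{min(n,m_v)}`; named PUBLISHED facts `hWu hpar h415 h310 hGZK hPT hEP`). No squarefree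
hypothesis is needed here. [cite: MazurTateTeitelbaum1986Invent, §I.17–I.18]
[cite: GreenbergLNM1716, Prop. 3.10, Prop. 4.15 (ii), §5 pp. 114–118, p. 137] [cite: Wuthrich2014, Thm. 16 (p. 397)] -/
theorem X2.mazurMainConjectureAt_of_analyticLambdaEq_of_towerBudget' (hodd : p ≠ 2)
    (hWu : thm16_charIdeal_dvd_multiplicative_of_reducible)
    (hpar : nonempty_modularParametrizationData)
    (h415 : prop415ii_noFiniteSubmodule_of_ordinary_or_multiplicative)
    (h310 : prop310_selmerCorank_mod_two_eq_lambdaInvariant)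
    (hGZK : rank_eq_analyticRank_of_analyticRank_le_one)
    (n : ℕ)
    (hPT : ∀ (κ : ZpExtension ℚ p) [NumberField (κ.layer n)], κ.IsCyclotomic →
      poitouTate_selmerStructure_duality (κ.layer n))
    (hEP : ∀ (κ : ZpExtension ℚ p) [NumberField (κ.layer n)], κ.IsCyclotomic →
      ∀ w : HeightOneSpectrum (𝓞 (κ.layer n)),
      localEulerPoincareCharacteristic (w.adicCompletion (κ.layer n)))
    (hmult : W.HasMultiplicativeReductionAtPrime p) (htors : p ∣ W.torsionOrder)
    (hfac : (W.torsionOrder).factorization p = 1) (hr0 : W.analyticRank = 0)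
    (S : Finset (HeightOneSpectrum (𝓞 ℚ))) (m : HeightOneSpectrum (𝓞 ℚ) → ℕ)
    (hSp : ∀ v ∈ S, ((p : ℕ) : 𝓞 ℚ) ∉ v.asIdeal)
    (hval : ∀ v ∈ S, padicValNat p (v.residueCard ^ (p - 1) - 1) = m v + 1)
    (hcv : ∀ v ∈ S,
      p ∣ (W.baseChange (v.adicCompletion ℚ)).localTamagawaNumber (v.adicCompletionIntegers ℚ))
    {N : ℕ} (hμ0 : X2.AnalyticMuLE W p 0) (hlam : X2.AnalyticLambdaEq W p N)
    (hN : N ≤ ∑ v ∈ S, p ^ min n (m v)) :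
    X2.MazurMainConjectureAt W p := by
  have hp3 : 3 ≤ p := by have h2 := hp.out.two_le; omega
  have hred : ¬ W.HasIrreducibleModPGaloisRep p :=
    not_hasIrreducibleModPGaloisRep_of_dvd_torsionOrder W p htors
  have hsplit : W.HasSplitMultiplicativeReductionAtPrime p :=
    X2.hasSplitMultiplicativeReductionAtPrime_of_dvd_torsionOrder W p hp3 hmult htors
  have hNodd : Odd N := by
    have h := (X2.analyticLambdaEq_parity hWu hpar W p hodd hmult hred hμ0 hlam).2 hsplit
    rwa [hr0, add_zero] at h
  exact X2.mazurMainConjectureAt_of_analyticLambdaEq_of_towerBudget hodd hWu hpar h415 h310 hGZK n hPT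
    hEP hmult htors hfac hr0 S m hSp hval hcv hμ0 hlam hNodd hN

end RouteT

end Summit.BirchSwinnertonDyer.BirchSwinnertonDyer.Theorems.EisensteinPrimesMazurTwinFamilyTowerRouteTParity

end
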